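import Summits.Ventures.PercRepro.S1CFCapsTools

/-!
# PercRepro — `D₃ ≤ 52`: THE DEPENDENT `3`-SETS OF A LOOPLESS COLOOP-FREE MATROID OF NULLITY `4` ON `12` POINTS (p1, gen 37)

The cap `D₃` of p7's ν = 4 program (the value of the extremal `N` = a parallel class of `4` ⊕ `U(7, 8)`: `6 · 8 + 4`).
A dependent `3`-set contains a dependent pair or is a triangle (a circuit of size `3`); with `d = D₂ ≤ 6` dependent pairs:
* `d ≤ 3`: the `3`-sets with a dependent pair number `≤ 10 · d ≤ 30` and the triangles `≤ C(6, 3) = 20` (the circuit count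
  at nullity `4`): `≤ 50`;
* `4 ≤ d ≤ 5`: no triangles (LEMMA K), `≤ 10 · d ≤ 50`;
* `d = 6`: no triangles, and every dependent pair lies in the class `F = cl {x}` of one of them, which has `4` points
  (`d ≤ C(|F|, 2) + C(5 − |F|, 2)` forces `|F| = 4` and no pair outside `F`); the dependent `3`-sets are the `3`-sets meeting
  `F` in `≥ 2` points: `≤ C(4, 2) · C(8, 1) + C(4, 3) · C(8, 0) = 52`.
**`ncard_dep_three_le_fiftytwo`** (`N.Dep` form) and **`ncard_three_eRk_le_two_le_fiftytwo`** (the `eRk ≤ 2` form of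
S2ContractionRankExact). Nothing about any cell is claimed. Axioms: standard.
-/

open scoped Matroid

namespace PercRepro

namespace S1CF

open Set

variable {α : Type}

/-- `d ≤ C(|F|, 2) + C(5 − |F|, 2)` for the class `F = cl {x}` of a dependent pair `{x, y}`. -/
theorem ncard_dep_pairs_le_choose_add (M : Matroid α) [M.Finite] (hL : ∀ e ∈ M.E, ¬ M.IsLoop e)
    (hK : ∀ e, ¬ M.IsColoop e) (hd : M.E.encard = M.eRank + ((4 : ℕ) : ℕ∞)) (hn : M.E.ncard = 12)
    {x y : α} (hxy : x ≠ y) (hxE : x ∈ M.E) (hyE : y ∈ M.E) (hdep : M.Dep {x, y}) :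
    {P : Set α | P ⊆ M.E ∧ P.ncard = 2 ∧ M.Dep P}.ncard ≤
      (M.closure {x}).ncard.choose 2 + (5 - (M.closure {x}).ncard).choose 2 := by
  classical
  have hEfin := M.ground_finite
  set F := M.closure {x} with hFdef
  have hF : F ⊆ M.E := M.closure_subset_ground _
  have hFfin : F.Finite := hEfin.subset hF
  have hcount_out := ncard_dep_pairs_not_subset_closure_le M hL hK hd hn hxy hxE hyE hdep
  have hcount_in : {P : Set α | P ⊆ M.E ∧ P.ncard = 2 ∧ M.Dep P ∧ P ⊆ F}.ncard ≤ F.ncard.choose 2 := by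
    have hsub : {P : Set α | P ⊆ M.E ∧ P.ncard = 2 ∧ M.Dep P ∧ P ⊆ F} ⊆ {X : Set α | X ⊆ F ∧ X.ncard = 2} :=
      fun P hP => ⟨hP.2.2.2, hP.2.1⟩
    rw [← ncard_subsets_eq_choose hFfin 2]
    exact Set.ncard_le_ncard hsub (hFfin.finite_subsets.subset (fun X hX => hX.1))
  have hsplit : {P : Set α | P ⊆ M.E ∧ P.ncard = 2 ∧ M.Dep P} ⊆
      {P : Set α | P ⊆ M.E ∧ P.ncard = 2 ∧ M.Dep P ∧ P ⊆ F} ∪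
        {P : Set α | P ⊆ M.E ∧ P.ncard = 2 ∧ M.Dep P ∧ ¬ P ⊆ F} := by
    intro P hP
    by_cases h : P ⊆ F
    · exact Or.inl ⟨hP.1, hP.2.1, hP.2.2, h⟩
    · exact Or.inr ⟨hP.1, hP.2.1, hP.2.2, h⟩
  calc {P : Set α | P ⊆ M.E ∧ P.ncard = 2 ∧ M.Dep P}.ncard
      ≤ ({P : Set α | P ⊆ M.E ∧ P.ncard = 2 ∧ M.Dep P ∧ P ⊆ F} ∪
          {P : Set α | P ⊆ M.E ∧ P.ncard = 2 ∧ M.Dep P ∧ ¬ P ⊆ F}).ncard :=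
        Set.ncard_le_ncard hsplit ((hEfin.finite_subsets.subset (fun P hP => hP.1)).union
          (hEfin.finite_subsets.subset (fun P hP => hP.1)))
    _ ≤ {P : Set α | P ⊆ M.E ∧ P.ncard = 2 ∧ M.Dep P ∧ P ⊆ F}.ncard +
          {P : Set α | P ⊆ M.E ∧ P.ncard = 2 ∧ M.Dep P ∧ ¬ P ⊆ F}.ncard := Set.ncard_union_le _ _
    _ ≤ F.ncard.choose 2 + (5 - F.ncard).choose 2 := add_le_add hcount_in hcount_out

/-- **With `6` dependent pairs they all lie in one class of `4` points**: for a dependent pair `{x, y}`, `|cl {x}| = 4` and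
every dependent pair is inside `cl {x}`. -/
theorem closure_singleton_of_six_dep_pairs (M : Matroid α) [M.Finite] (hL : ∀ e ∈ M.E, ¬ M.IsLoop e)
    (hK : ∀ e, ¬ M.IsColoop e) (hd : M.E.encard = M.eRank + ((4 : ℕ) : ℕ∞)) (hn : M.E.ncard = 12)
    (h6 : 6 ≤ {P : Set α | P ⊆ M.E ∧ P.ncard = 2 ∧ M.Dep P}.ncard)
    {x y : α} (hxy : x ≠ y) (hxE : x ∈ M.E) (hyE : y ∈ M.E) (hdep : M.Dep {x, y}) :
    (M.closure {x}).ncard = 4 ∧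
      ∀ P, P ⊆ M.E → P.ncard = 2 → M.Dep P → P ⊆ M.closure {x} := by
  have hEfin := M.ground_finite
  have hF4 : (M.closure {x}).ncard ≤ 4 := ncard_closure_singleton_le_four M hK hd hn x
  have hle := ncard_dep_pairs_le_choose_add M hL hK hd hn hxy hxE hyE hdep
  have hF2 : 2 ≤ (M.closure {x}).ncard := by
    have : ({x, y} : Set α) ⊆ M.closure {x} := by
      intro w hw; rcases hw with rfl | rfl
      · exact M.mem_closure_self w hxE
      · exact mem_closure_singleton_of_dep_pair M hxE (hL x hxE) hdep
    rw [← Set.ncard_pair hxy]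
    exact Set.ncard_le_ncard this (hEfin.subset (M.closure_subset_ground _))
  have hFeq : (M.closure {x}).ncard = 4 := by
    have hb : ∀ f : ℕ, 2 ≤ f → f ≤ 4 → f ≠ 4 → f.choose 2 + (5 - f).choose 2 ≤ 4 := by
      intro f h2 h4 hne
      interval_cases f <;> simp_all
    by_contra hne
    have := hb _ hF2 hF4 hne
    omega
  refine ⟨hFeq, fun P hPE hP2 hPdep => ?_⟩
  by_contra hPF
  have hout := ncard_dep_pairs_not_subset_closure_le M hL hK hd hn hxy hxE hyE hdep
  rw [hFeq] at hout
  have hmem : P ∈ {P : Set α | P ⊆ M.E ∧ P.ncard = 2 ∧ M.Dep P ∧ ¬ P ⊆ M.closure {x}} :=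
    ⟨hPE, hP2, hPdep, hPF⟩
  have hpos : 0 < {P : Set α | P ⊆ M.E ∧ P.ncard = 2 ∧ M.Dep P ∧ ¬ P ⊆ M.closure {x}}.ncard := by
    rw [Set.ncard_pos (hEfin.finite_subsets.subset (fun P hP => hP.1))]
    exact ⟨P, hmem⟩
  norm_num at hout
  omega

/-- The triangles number at most `20` (the circuit count at nullity `4`). -/
theorem ncard_triangles_le_twenty (M : Matroid α) [M.Finite] (hd : M.E.encard = M.eRank + ((4 : ℕ) : ℕ∞)) :
    {C : Set α | C ⊆ M.E ∧ M.IsCircuit C ∧ C.ncard = 3}.ncard ≤ 20 := by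
  have h := ncard_isCircuit_ncard_eq_le M (ν := 4) (k := 3) (by norm_num) (subset_refl M.E)
    (ncard_ground_eq_eRk_toNat_add M hd).le
  norm_num at h
  exact h

/-- **`D₃ ≤ 52`**: the dependent `3`-sets number at most `52`. -/
theorem ncard_dep_three_le_fiftytwo (M : Matroid α) [M.Finite] (hL : ∀ e ∈ M.E, ¬ M.IsLoop e)
    (hK : ∀ e, ¬ M.IsColoop e) (hd : M.E.encard = M.eRank + ((4 : ℕ) : ℕ∞)) (hn : M.E.ncard = 12) :
    {X : Set α | X ⊆ M.E ∧ X.ncard = 3 ∧ M.Dep X}.ncard ≤ 52 := by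
  classical
  have hEfin := M.ground_finite
  set 𝒟₂ := {P : Set α | P ⊆ M.E ∧ P.ncard = 2 ∧ M.Dep P} with h𝒟₂
  set A := {X : Set α | X ⊆ M.E ∧ X.ncard = 3 ∧ ∃ P ⊆ X, P.ncard = 2 ∧ M.Dep P} with hA
  set T := {C : Set α | C ⊆ M.E ∧ M.IsCircuit C ∧ C.ncard = 3} with hT
  have hAfin : A.Finite := hEfin.finite_subsets.subset (fun X hX => hX.1)
  have hTfin : T.Finite := hEfin.finite_subsets.subset (fun X hX => hX.1)
  have hsplit : {X : Set α | X ⊆ M.E ∧ X.ncard = 3 ∧ M.Dep X} ⊆ A ∪ T := by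
    intro X hX
    obtain ⟨hXE, hX3, hXdep⟩ := hX
    by_cases h : ∃ P ⊆ X, P.ncard = 2 ∧ M.Dep P
    · exact Or.inl ⟨hXE, hX3, h⟩
    · push Not at h
      exact Or.inr ⟨hXE, isCircuit_of_dep_three_of_no_dep_pair M hXE hX3 hXdep h, hX3⟩
  have hAle : A.ncard ≤ 10 * 𝒟₂.ncard := by
    have := ncard_with_dep_pair_le M 3
    rw [hn] at this
    norm_num at this
    exact this
  have hTle : T.ncard ≤ 20 := ncard_triangles_le_twenty M hd
  have hd6 : 𝒟₂.ncard ≤ 6 := ncard_dep_pairs_le_six M hL hK hd hn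
  have htot : {X : Set α | X ⊆ M.E ∧ X.ncard = 3 ∧ M.Dep X}.ncard ≤ A.ncard + T.ncard :=
    (Set.ncard_le_ncard hsplit (hAfin.union hTfin)).trans (Set.ncard_union_le _ _)
  by_cases h4 : 4 ≤ 𝒟₂.ncard
  · -- no triangles
    have hTe : T = ∅ := by
      rw [Set.eq_empty_iff_forall_notMem]
      intro C hC
      obtain ⟨-, hCc, hC3⟩ := hC
      exact not_isCircuit_of_four_le_ncard_dep_pairs M hL hK hd hn h4 hCc (by omega) (by omega)
    have hT0 : T.ncard = 0 := by rw [hTe]; simp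
    by_cases h6 : 6 ≤ 𝒟₂.ncard
    · -- the class of four
      obtain ⟨P₀, hP₀⟩ : 𝒟₂.Nonempty := by
        rw [← Set.ncard_pos (hEfin.finite_subsets.subset (fun P hP => hP.1))]; omega
      obtain ⟨hP₀E, hP₀2, hP₀dep⟩ := hP₀
      obtain ⟨x, y, hxy, rfl⟩ := Set.ncard_eq_two.1 hP₀2
      have hxE : x ∈ M.E := hP₀E (by simp)
      have hyE : y ∈ M.E := hP₀E (by simp)
      obtain ⟨hF4, hall⟩ := closure_singleton_of_six_dep_pairs M hL hK hd hn h6 hxy hxE hyE hP₀dep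
      set F := M.closure {x} with hFdef
      have hF : F ⊆ M.E := M.closure_subset_ground _
      have hEF : (M.E \ F).ncard = 8 := by
        have := Set.ncard_sdiff_add_ncard_of_subset hF hEfin
        omega
      -- every member of `A` meets `F` in 2 or 3 points
      have hA2 : A ⊆ {X : Set α | X ⊆ M.E ∧ X.ncard = 3 ∧ (X ∩ F).ncard = 2} ∪
          {X : Set α | X ⊆ M.E ∧ X.ncard = 3 ∧ (X ∩ F).ncard = 3} := by
        intro X hX
        obtain ⟨hXE, hX3, P, hPX, hP2, hPdep⟩ := hX
        have hXfin : X.Finite := hEfin.subset hXE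
        have hPF : P ⊆ F := hall P (hPX.trans hXE) hP2 hPdep
        have hPXF : P ⊆ X ∩ F := subset_inter hPX hPF
        have h2 : 2 ≤ (X ∩ F).ncard := by
          rw [← hP2]; exact Set.ncard_le_ncard hPXF (hXfin.subset inter_subset_left)
        have h3 : (X ∩ F).ncard ≤ 3 := by
          rw [← hX3]; exact Set.ncard_le_ncard inter_subset_left hXfin
        rcases Nat.lt_or_ge (X ∩ F).ncard 3 with hlt | hge
        · exact Or.inl ⟨hXE, hX3, by omega⟩
        · exact Or.inr ⟨hXE, hX3, by omega⟩
      have hc2 := ncard_inter_eq_le hEfin hF 3 2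
      have hc3 := ncard_inter_eq_le hEfin hF 3 3
      rw [hF4, hEF] at hc2 hc3
      norm_num at hc2 hc3
      have hAle' : A.ncard ≤ 52 := by
        calc A.ncard ≤ ({X : Set α | X ⊆ M.E ∧ X.ncard = 3 ∧ (X ∩ F).ncard = 2} ∪
              {X : Set α | X ⊆ M.E ∧ X.ncard = 3 ∧ (X ∩ F).ncard = 3}).ncard :=
              Set.ncard_le_ncard hA2 ((hEfin.finite_subsets.subset (fun X hX => hX.1)).union
                (hEfin.finite_subsets.subset (fun X hX => hX.1)))
          _ ≤ {X : Set α | X ⊆ M.E ∧ X.ncard = 3 ∧ (X ∩ F).ncard = 2}.ncard +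
              {X : Set α | X ⊆ M.E ∧ X.ncard = 3 ∧ (X ∩ F).ncard = 3}.ncard := Set.ncard_union_le _ _
          _ ≤ 48 + 4 := add_le_add hc2 hc3
          _ = 52 := by norm_num
      omega
    · omega
  · omega

/-- **`D₃ ≤ 52`, rank form**: the `3`-sets of rank `≤ 2` number at most `52`. -/
theorem ncard_three_eRk_le_two_le_fiftytwo (M : Matroid α) [M.Finite] (hL : ∀ e ∈ M.E, ¬ M.IsLoop e)
    (hK : ∀ e, ¬ M.IsColoop e) (hd : M.E.encard = M.eRank + ((4 : ℕ) : ℕ∞)) (hn : M.E.ncard = 12) :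
    {X : Set α | X ⊆ M.E ∧ X.ncard = 3 ∧ M.eRk X ≤ 2}.ncard ≤ 52 := by
  have hEfin := M.ground_finite
  have hsub : {X : Set α | X ⊆ M.E ∧ X.ncard = 3 ∧ M.eRk X ≤ 2} ⊆
      {X : Set α | X ⊆ M.E ∧ X.ncard = 3 ∧ M.Dep X} := by
    intro X hX
    obtain ⟨hXE, hX3, hXr⟩ := hX
    refine ⟨hXE, hX3, ?_⟩
    have hXfin : X.Finite := hEfin.subset hXE
    rw [← Matroid.eRk_lt_encard_iff_dep_of_finite hXfin hXE, ← hXfin.cast_ncard_eq, hX3]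
    exact lt_of_le_of_lt hXr (by norm_num)
  exact (Set.ncard_le_ncard hsub (hEfin.finite_subsets.subset (fun X hX => hX.1))).trans
    (ncard_dep_three_le_fiftytwo M hL hK hd hn)

end S1CF

end PercRepro
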